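import Literature.NumberTheory.Automorphic.UnitaryGroupPairArthurTraceTwo
import Literature.NumberTheory.Automorphic.UnitaryGroupArthurTraceSpelledCMTwo
import HarnessLib

/-!
# The pair road `H = U(J₂) × U(Φ₁)`: `J_H(f)` explicit, slice by slice

[Rogawski1990, §7.3 (p. 98) «`G = U(2) × U(1)`»]. Part (ii) of the step-2 file of the pair road (part (i) = ★
`UnitaryGroupPairArthurTraceTwo`: `J(0) = 0`, slice sums independent of the live finite set). The H-side distribution of the
endoscopic group `H = U(J₂) × U(Φ₁)` is WRITTEN `J_H(f) = μ₁(X₁) · Σ_{γ₁ ∈ S₁} J_{U(J₂)}(f_{γ₁})` (pen-#1 letter WORD #8, D0.3: slices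
`f_{γ₁} = f(·, γ₁)`, `γ₁ ∈ U(Φ₁)(L⁺)`, any finite `S₁ ⊇` live set, `μ₁` the finite invariant measure of the compact factor
`X₁ = U(Φ₁)(L⁺)∖U(Φ₁)(𝔸)`); this file makes it EXPLICIT by summing the explicit trace formula of `U(J₂)` at the CM pin (★
`arthurTrace_eq_spelled_cm_two`: elliptic orbital sum + Prop. 7.3.1 central terms + (6.1.3) hyperbolic weighted orbital integrals) over the slices:

* `pairArthurTrace_eq_sum_explicit_cm_two` — the floor-0 H-side closing line «`J_H(f^H)` explicit».

No definitions. [cite: Rogawski1990, §7.3 (p. 98)] [cite: Rogawski1990, Prop. 7.3.1 (p. 97)] [cite: Rogawski1990, §6.1 (6.1.3)]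
[cite: Rogawski1990, §2.3 (p. 14)]
-/

noncomputable section

open MeasureTheory MeasureTheory.Measure NumberField IsDedekindDomain Set Matrix Polynomial
open Literature.MeasureTheory.Group
open Literature.NumberTheory.Automorphic.Meyer
open Literature.NumberTheory.GaloisRepresentations (quadraticArtinIndicator)
open scoped NNReal ENNReal Classical MatrixGroups

namespace Literature.NumberTheory.Automorphic

namespace UnitaryGroup

/-- **`J_H(f)` EXPLICIT FOR THE PAIR `H = U(J₂) × U(Φ₁)` over a CM field** — the floor-0 H-side closing line «`J_H(f^H)` explicit»
[Rogawski1990, §7.3 (p. 98) «`G = U(2) × U(1)`»; Prop. 7.3.1; (6.1.3); §2.3 (p. 14)]. For a test function `f` on `U(J₂)(𝔸) × U(Φ₁)(𝔸)`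
whose slices `f_{γ₁} = f(·, γ₁)` (`γ₁ ∈ U(Φ₁)(L⁺)`) are quasi-split test functions, the finite invariant measure `μ₁` of the compact factor and
any finite set `S₁` of slices (the written `J_H(f) = μ₁(X₁) · Σ_{γ₁ ∈ S₁} J_{U(J₂)}(f_{γ₁})`, pen-#1 letter WORD #8 D0.3; independent of the
live `S₁` by ★ `smul_sum_arthurTrace_slice_eq_of_live`): there is ONE Haar scalar `𝔠 > 0` and there are representatives
`zrep γ₁` (keys of the central classes) and `hyrep γ₁` (regular hyperbolic classes), slice by slice, with
**`J_H(f) = μ₁(X₁) · Σ_{γ₁ ∈ S₁} [elliptic orbital sum of f_{γ₁} + Σ_central (μ(X)·f_{γ₁}(ζ·1) + c_μ·𝔠·𝔟₀(φ_ζ[f_{γ₁}])) − c_μ·C_w·Σ_hyperbolic J^v(·, f_{γ₁})]`**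
— ★ `arthurTrace_eq_spelled_cm_two` summed over the slices (`Finset.sum_congr`, the scalar chosen before the slices).
[cite: Rogawski1990, §7.3 (p. 98)] [cite: Rogawski1990, Prop. 7.3.1 (p. 97)] [cite: Rogawski1990, §6.1 (6.1.3)] [cite: Rogawski1990, §2.3 (p. 14)] -/
theorem pairArthurTrace_eq_sum_explicit_cm_two (L : Type) [Field L] [NumberField L] [IsCMField L] (Φ₁ : Matrix (Fin 1) (Fin 1) L)
    (hij : (((0 : Fin 2) : Fin 2) : ℕ) + 1 = (((1 : Fin 2) : Fin 2) : ℕ)) (hN : 2 = 2 * (((0 : Fin 2) : Fin 2) : ℕ) + 2)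
    [instMA : MeasurableSpace (quasiSplit (↥(maximalRealSubfield L)) L (IsCMField.complexConj L) 2).Adelic] [instBA : BorelSpace (quasiSplit (↥(maximalRealSubfield L)) L (IsCMField.complexConj L) 2).Adelic]
    (ν : Measure (quasiSplit (↥(maximalRealSubfield L)) L (IsCMField.complexConj L) 2).Adelic) [instν : IsHaarMeasure ν]
    (μ : Measure (quasiSplit (↥(maximalRealSubfield L)) L (IsCMField.complexConj L) 2).automorphicQuotient)
    [instμ : (quasiSplit (↥(maximalRealSubfield L)) L (IsCMField.complexConj L) 2).IsAutomorphicMeasure μ]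
    [instMU : MeasurableSpace (adelicUnipotent (↥(maximalRealSubfield L)) L (IsCMField.complexConj L) 2)]
    [instBU : BorelSpace (adelicUnipotent (↥(maximalRealSubfield L)) L (IsCMField.complexConj L) 2)]
    [instMAF : MeasurableSpace (AdeleRing (𝓞 (↥(maximalRealSubfield L))) (↥(maximalRealSubfield L)))]
    [instBAF : BorelSpace (AdeleRing (𝓞 (↥(maximalRealSubfield L))) (↥(maximalRealSubfield L)))]
    [instMI : MeasurableSpace (GaloisRepresentations.ideleGroup (↥(maximalRealSubfield L)))]
    [instBI : BorelSpace (GaloisRepresentations.ideleGroup (↥(maximalRealSubfield L)))]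
    [instMAL : MeasurableSpace (AdeleRing (𝓞 L) L)] [instBAL : BorelSpace (AdeleRing (𝓞 L) L)]
    [instMQ : ∀ γ : (quasiSplit (↥(maximalRealSubfield L)) L (IsCMField.complexConj L) 2).Adelic,
      MeasurableSpace ((quasiSplit (↥(maximalRealSubfield L)) L (IsCMField.complexConj L) 2).Adelic ⧸
        Subgroup.centralizer ({γ} : Set (quasiSplit (↥(maximalRealSubfield L)) L (IsCMField.complexConj L) 2).Adelic))]
    [instBQ : ∀ γ : (quasiSplit (↥(maximalRealSubfield L)) L (IsCMField.complexConj L) 2).Adelic,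
      BorelSpace ((quasiSplit (↥(maximalRealSubfield L)) L (IsCMField.complexConj L) 2).Adelic ⧸
        Subgroup.centralizer ({γ} : Set (quasiSplit (↥(maximalRealSubfield L)) L (IsCMField.complexConj L) 2).Adelic))]
    [instMS : ∀ γ : (quasiSplit (↥(maximalRealSubfield L)) L (IsCMField.complexConj L) 2).Adelic,
      MeasurableSpace (↥(Subgroup.centralizer ({γ} : Set (quasiSplit (↥(maximalRealSubfield L)) L (IsCMField.complexConj L) 2).Adelic)) ⧸
        ((quasiSplit (↥(maximalRealSubfield L)) L (IsCMField.complexConj L) 2).quotientSubgroup ⊓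
          Subgroup.centralizer ({γ} : Set (quasiSplit (↥(maximalRealSubfield L)) L (IsCMField.complexConj L) 2).Adelic)).subgroupOf
          (Subgroup.centralizer ({γ} : Set (quasiSplit (↥(maximalRealSubfield L)) L (IsCMField.complexConj L) 2).Adelic)))]
    [instBS : ∀ γ : (quasiSplit (↥(maximalRealSubfield L)) L (IsCMField.complexConj L) 2).Adelic,
      BorelSpace (↥(Subgroup.centralizer ({γ} : Set (quasiSplit (↥(maximalRealSubfield L)) L (IsCMField.complexConj L) 2).Adelic)) ⧸
        ((quasiSplit (↥(maximalRealSubfield L)) L (IsCMField.complexConj L) 2).quotientSubgroup ⊓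
          Subgroup.centralizer ({γ} : Set (quasiSplit (↥(maximalRealSubfield L)) L (IsCMField.complexConj L) 2).Adelic)).subgroupOf
          (Subgroup.centralizer ({γ} : Set (quasiSplit (↥(maximalRealSubfield L)) L (IsCMField.complexConj L) 2).Adelic)))]
    (ν₀ : Measure (adelicUnipotent (↥(maximalRealSubfield L)) L (IsCMField.complexConj L) 2)) [instν₀ : ν₀.IsHaarMeasure]
    (𝓕 : Set (adelicUnipotent (↥(maximalRealSubfield L)) L (IsCMField.complexConj L) 2))
    (h𝓕 : IsFundamentalDomain (rationalUnipotent (↥(maximalRealSubfield L)) L (IsCMField.complexConj L) 2) 𝓕 ν₀)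
    (rep : ConjClasses ↥(quasiSplit (↥(maximalRealSubfield L)) L (IsCMField.complexConj L) 2).arithmeticSubgroup → ↥(quasiSplit (↥(maximalRealSubfield L)) L (IsCMField.complexConj L) 2).arithmeticSubgroup)
    (hrep : ∀ s, ConjClasses.mk (rep s) = s)
    (νC : ∀ s : ConjClasses ↥(quasiSplit (↥(maximalRealSubfield L)) L (IsCMField.complexConj L) 2).arithmeticSubgroup,
      Measure ↥(Subgroup.centralizer ({((rep s : ↥(quasiSplit (↥(maximalRealSubfield L)) L (IsCMField.complexConj L) 2).arithmeticSubgroup) : (quasiSplit (↥(maximalRealSubfield L)) L (IsCMField.complexConj L) 2).Adelic)} : Set (quasiSplit (↥(maximalRealSubfield L)) L (IsCMField.complexConj L) 2).Adelic)))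
    [instνC : ∀ s, IsHaarMeasure (νC s)]
    (f : (quasiSplit (↥(maximalRealSubfield L)) L (IsCMField.complexConj L) 2).Adelic × (cmDatum L 1 Φ₁).Adelic → ℂ)
    (hslice : ∀ γ₁ : (cmDatum L 1 Φ₁).arithmeticSubgroup,
      IsQuasiSplitTest (↥(maximalRealSubfield L)) L (IsCMField.complexConj L) 2 (fun g₂ : (quasiSplit (↥(maximalRealSubfield L)) L (IsCMField.complexConj L) 2).Adelic => f (g₂, ((γ₁ : (cmDatum L 1 Φ₁).arithmeticSubgroup) : (cmDatum L 1 Φ₁).Adelic))))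
    (μ₁ : Measure (cmDatum L 1 Φ₁).automorphicQuotient) (S₁ : Finset (cmDatum L 1 Φ₁).arithmeticSubgroup)
    [MeasurableSpace ((quasiSplit (↥(maximalRealSubfield L)) L (IsCMField.complexConj L) 2).Adelic ⧸
      torusAdelic (↥(maximalRealSubfield L)) L (IsCMField.complexConj L) 2)]
    [BorelSpace ((quasiSplit (↥(maximalRealSubfield L)) L (IsCMField.complexConj L) 2).Adelic ⧸
      torusAdelic (↥(maximalRealSubfield L)) L (IsCMField.complexConj L) 2)]
    (ρ : Measure ↥(torusAdelic (↥(maximalRealSubfield L)) L (IsCMField.complexConj L) 2)) [ρ.IsHaarMeasure] [ρ.IsInvInvariant]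
    {w : (quasiSplit (↥(maximalRealSubfield L)) L (IsCMField.complexConj L) 2).Rational}
    (hw : ((w.1 : GL (Fin 2) L) : Matrix (Fin 2) (Fin 2) L) = !![(0 : L), 1; 1, 0])
    {Cw : ℝ≥0∞} (hC : Cw ≠ ⊤)
    (hwin : ∀ β' : torusInBorel (↥(maximalRealSubfield L)) L (IsCMField.complexConj L) 2 → ℝ≥0∞,
        IsCoveringWeight ((rationalBorel (↥(maximalRealSubfield L)) L (IsCMField.complexConj L) 2).subgroupOf
          (torusInBorel (↥(maximalRealSubfield L)) L (IsCMField.complexConj L) 2)) β' →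
        ∀ A B : ℝ≥0, 0 < A → A ≤ B →
          ∫⁻ s : torusInBorel (↥(maximalRealSubfield L)) L (IsCMField.complexConj L) 2, β' s *
            {s : torusInBorel (↥(maximalRealSubfield L)) L (IsCMField.complexConj L) 2 |
              A < borelHeight (((s : torusInBorel (↥(maximalRealSubfield L)) L (IsCMField.complexConj L) 2) :
                borelAdelic (↥(maximalRealSubfield L)) L (IsCMField.complexConj L) 2) :
                (quasiSplit (↥(maximalRealSubfield L)) L (IsCMField.complexConj L) 2).Adelic) ∧
              borelHeight (((s : torusInBorel (↥(maximalRealSubfield L)) L (IsCMField.complexConj L) 2) :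
                borelAdelic (↥(maximalRealSubfield L)) L (IsCMField.complexConj L) 2) :
                (quasiSplit (↥(maximalRealSubfield L)) L (IsCMField.complexConj L) 2).Adelic) ≤ B}.indicator 1 s
            ∂(Measure.map (⇑(Subgroup.subgroupOfEquivOfLe
              (torusAdelic_le_borelAdelic (F := ↥(maximalRealSubfield L)) (E := L) (c := IsCMField.complexConj L) (N := 2))).symm) ρ :
                Measure (torusInBorel (↥(maximalRealSubfield L)) L (IsCMField.complexConj L) 2)) =
            Cw * ENNReal.ofReal (Real.log (B : ℝ) - Real.log (A : ℝ)))
    {β : (quasiSplit (↥(maximalRealSubfield L)) L (IsCMField.complexConj L) 2).Adelic → ℝ≥0∞}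
    (hβ : IsCoveringWeight ((arithmeticBorel (↥(maximalRealSubfield L)) L (IsCMField.complexConj L) 2).map (quasiSplit (↥(maximalRealSubfield L)) L (IsCMField.complexConj L) 2).arithmeticSubgroup.subtype) β)
    (μB : Measure (borelAdelic (↥(maximalRealSubfield L)) L (IsCMField.complexConj L) 2)) [instμB : μB.IsHaarMeasure]
    (μK : Measure ((standardMaximalCompactGL 2 L).comap
      (adelicVal (↥(maximalRealSubfield L)) L (IsCMField.complexConj L) 2 ((StdForm.antidiagonal 2).over L)) : Subgroup (quasiSplit (↥(maximalRealSubfield L)) L (IsCMField.complexConj L) 2).Adelic))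
    [instμK : μK.IsHaarMeasure]
    (μT : Measure (torusInBorel (↥(maximalRealSubfield L)) L (IsCMField.complexConj L) 2)) [instμT : μT.IsHaarMeasure]
    (μN : Measure (unipotentInBorel (↥(maximalRealSubfield L)) L (IsCMField.complexConj L) 2)) [instμN : μN.IsHaarMeasure]
    {Ω : Set (unipotentInBorel (↥(maximalRealSubfield L)) L (IsCMField.complexConj L) 2)} (hΩ : MeasurableSet Ω)
    (hΩu : ∀ n : unipotentInBorel (↥(maximalRealSubfield L)) L (IsCMField.complexConj L) 2,
      ∃! γ : (((quasiSplit (↥(maximalRealSubfield L)) L (IsCMField.complexConj L) 2).arithmeticSubgroup).subgroupOf (borelAdelic (↥(maximalRealSubfield L)) L (IsCMField.complexConj L) 2)).subgroupOf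
        (unipotentInBorel (↥(maximalRealSubfield L)) L (IsCMField.complexConj L) 2), γ • n ∈ Ω)
    {wT : torusInBorel (↥(maximalRealSubfield L)) L (IsCMField.complexConj L) 2 → ℝ≥0∞}
    (hwT : IsCoveringWeight ((((quasiSplit (↥(maximalRealSubfield L)) L (IsCMField.complexConj L) 2).arithmeticSubgroup).subgroupOf (borelAdelic (↥(maximalRealSubfield L)) L (IsCMField.complexConj L) 2)).subgroupOf
      (torusInBorel (↥(maximalRealSubfield L)) L (IsCMField.complexConj L) 2)) wT)
    {δ : L} (hcδ : (IsCMField.complexConj L) δ = -δ) (hδ : δ ≠ 0) (θ₀ : 𝓞 (↥(maximalRealSubfield L))) (hθ : θ₀ ≠ 0)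
    (hd : δ * δ = algebraMap (↥(maximalRealSubfield L)) L (θ₀ : (↥(maximalRealSubfield L))))
    (μA : Measure (AdeleRing (𝓞 (↥(maximalRealSubfield L))) (↥(maximalRealSubfield L)))) [instμA : μA.IsAddHaarMeasure]
    (νF : Measure (GaloisRepresentations.ideleGroup (↥(maximalRealSubfield L)))) [instνF : νF.IsHaarMeasure]
    {𝓕F : Set (GaloisRepresentations.ideleGroup (↥(maximalRealSubfield L)))} (h𝓕F : IsIdeleClassDomain (↥(maximalRealSubfield L)) 𝓕F) :
    haveI := t2Space_quasiSplitAdelic (F := ↥(maximalRealSubfield L)) (E := L) (c := IsCMField.complexConj L) (N := 2)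
    haveI := locallyCompactSpace_quasiSplitAdelic (F := ↥(maximalRealSubfield L)) (E := L) (c := IsCMField.complexConj L) (N := 2)
    haveI := secondCountableTopology_quasiSplitAdelic (F := ↥(maximalRealSubfield L)) (E := L) (c := IsCMField.complexConj L) (N := 2)
    haveI : IsClosed (((quasiSplit (↥(maximalRealSubfield L)) L (IsCMField.complexConj L) 2).quotientSubgroup : Set (quasiSplit (↥(maximalRealSubfield L)) L (IsCMField.complexConj L) 2).Adelic)) :=
      isClosed_quotientSubgroup_quasiSplit
    haveI : ∀ γ : (quasiSplit (↥(maximalRealSubfield L)) L (IsCMField.complexConj L) 2).Adelic, IsClosed ((Subgroup.centralizer ({γ} : Set (quasiSplit (↥(maximalRealSubfield L)) L (IsCMField.complexConj L) 2).Adelic) :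
        Subgroup (quasiSplit (↥(maximalRealSubfield L)) L (IsCMField.complexConj L) 2).Adelic) : Set (quasiSplit (↥(maximalRealSubfield L)) L (IsCMField.complexConj L) 2).Adelic) := isClosed_centralizer_quasiSplit
    haveI : ∀ γ : (quasiSplit (↥(maximalRealSubfield L)) L (IsCMField.complexConj L) 2).Adelic, (count : Measure ↥(((quasiSplit (↥(maximalRealSubfield L)) L (IsCMField.complexConj L) 2).quotientSubgroup ⊓
        Subgroup.centralizer ({γ} : Set (quasiSplit (↥(maximalRealSubfield L)) L (IsCMField.complexConj L) 2).Adelic)).subgroupOf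
          (Subgroup.centralizer ({γ} : Set (quasiSplit (↥(maximalRealSubfield L)) L (IsCMField.complexConj L) 2).Adelic)))).IsHaarMeasure :=
      isHaarMeasure_count_inf_centralizer_subgroupOf_quasiSplit
    haveI : (count : Measure (quasiSplit (↥(maximalRealSubfield L)) L (IsCMField.complexConj L) 2).quotientSubgroup).IsHaarMeasure :=
      isHaarMeasure_count_quotientSubgroup_quasiSplit
    haveI : ν.IsMulRightInvariant := isMulRightInvariant_quasiSplit_cm_two L ν
    letI := AdelicGroupData.measurableSpaceQuotientForm (quasiSplit (↥(maximalRealSubfield L)) L (IsCMField.complexConj L) 2)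
    haveI := AdelicGroupData.borelSpaceQuotientForm (quasiSplit (↥(maximalRealSubfield L)) L (IsCMField.complexConj L) 2)
    haveI := AdelicGroupData.smulInvariantMeasureQuotientForm (quasiSplit (↥(maximalRealSubfield L)) L (IsCMField.complexConj L) 2) μ
    haveI := AdelicGroupData.isFiniteMeasureOnCompactsQuotientForm (quasiSplit (↥(maximalRealSubfield L)) L (IsCMField.complexConj L) 2) μ
    haveI := t2Space_adeleRing_of_numberField L
    haveI := locallyCompactSpace_adeleRing' L
    haveI := secondCountableTopology_adeleRing L
    ∃ 𝔠 : ℝ, 0 < 𝔠 ∧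
      ∃ (zrep : (cmDatum L 1 Φ₁).arithmeticSubgroup → (AdeleRing (𝓞 L) L)[X] × Bool → ratOne (↥(maximalRealSubfield L)) L (IsCMField.complexConj L))
      (hyrep : (cmDatum L 1 Φ₁).arithmeticSubgroup → (AdeleRing (𝓞 L) L)[X] × Bool → (quasiSplit (↥(maximalRealSubfield L)) L (IsCMField.complexConj L) 2).Rational),
      (μ₁.real Set.univ : ℝ) • ∑ γ₁ ∈ S₁, arthurTrace μ ν₀ 𝓕 (fun g₂ : (quasiSplit (↥(maximalRealSubfield L)) L (IsCMField.complexConj L) 2).Adelic => f (g₂, ((γ₁ : (cmDatum L 1 Φ₁).arithmeticSubgroup) : (cmDatum L 1 Φ₁).Adelic))) =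
        (μ₁.real Set.univ : ℝ) • ∑ γ₁ ∈ S₁,
    ((∑ i ∈ (((finite_setOf_borelRefine_charpoly_of_isCompact (F := ↥(maximalRealSubfield L)) (E := L) (c := IsCMField.complexConj L) (N := 2)
              (hslice γ₁).hasCompactSupport'.isCompact).toFinset).filter (fun i => ∀ β : ↥(arithmeticBorel (↥(maximalRealSubfield L)) L (IsCMField.complexConj L) 2),
                (((adelicVal (↥(maximalRealSubfield L)) L (IsCMField.complexConj L) 2 _ ((β : ↥(quasiSplit (↥(maximalRealSubfield L)) L (IsCMField.complexConj L) 2).arithmeticSubgroup) : (quasiSplit (↥(maximalRealSubfield L)) L (IsCMField.complexConj L) 2).Adelic) :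
                    GL (Fin 2) (AdeleRing (𝓞 L) L)) : Matrix (Fin 2) (Fin 2) (AdeleRing (𝓞 L) L)).charpoly,
                  decide (∃ δ : ↥(quasiSplit (↥(maximalRealSubfield L)) L (IsCMField.complexConj L) 2).arithmeticSubgroup, δ * (β : ↥(quasiSplit (↥(maximalRealSubfield L)) L (IsCMField.complexConj L) 2).arithmeticSubgroup) * δ⁻¹ ∈ arithmeticBorel (↥(maximalRealSubfield L)) L (IsCMField.complexConj L) 2)) ≠ i)).attach,
              ((unfoldingConstant (quasiSplit (↥(maximalRealSubfield L)) L (IsCMField.complexConj L) 2).quotientSubgroup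
                  (count : Measure (quasiSplit (↥(maximalRealSubfield L)) L (IsCMField.complexConj L) 2).quotientSubgroup) μ ν : ℝ) : ℂ) *
                ∑' s : {s : ConjClasses ↥(quasiSplit (↥(maximalRealSubfield L)) L (IsCMField.complexConj L) 2).arithmeticSubgroup //
                    (((adelicVal (↥(maximalRealSubfield L)) L (IsCMField.complexConj L) 2 _ ((rep s : ↥(quasiSplit (↥(maximalRealSubfield L)) L (IsCMField.complexConj L) 2).arithmeticSubgroup) : (quasiSplit (↥(maximalRealSubfield L)) L (IsCMField.complexConj L) 2).Adelic) :
                    GL (Fin 2) (AdeleRing (𝓞 L) L)) : Matrix (Fin 2) (Fin 2) (AdeleRing (𝓞 L) L)).charpoly,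
                  decide (∃ δ : ↥(quasiSplit (↥(maximalRealSubfield L)) L (IsCMField.complexConj L) 2).arithmeticSubgroup, δ * (rep s : ↥(quasiSplit (↥(maximalRealSubfield L)) L (IsCMField.complexConj L) 2).arithmeticSubgroup) * δ⁻¹ ∈ arithmeticBorel (↥(maximalRealSubfield L)) L (IsCMField.complexConj L) 2)) = i.1},
                  (haveI : (νC s.1).IsMulRightInvariant :=
                      isMulRightInvariant_centralizer_of_forall_cl_ne_two
                        (isConjInvariant_borelRefine isConjInvariant_charpoly_adelicVal) (Finset.mem_filter.1 i.2).2 s.2 (νC s.1);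
                    haveI : (νC s.1).IsInvInvariant :=
                      isInvInvariant_centralizer_of_forall_cl_ne_two
                        (isConjInvariant_borelRefine isConjInvariant_charpoly_adelicVal) (Finset.mem_filter.1 i.2).2 s.2 (νC s.1);
                    ((quotientMeasure (((quasiSplit (↥(maximalRealSubfield L)) L (IsCMField.complexConj L) 2).quotientSubgroup ⊓
                        Subgroup.centralizer ({((rep s.1 : ↥(quasiSplit (↥(maximalRealSubfield L)) L (IsCMField.complexConj L) 2).arithmeticSubgroup) : (quasiSplit (↥(maximalRealSubfield L)) L (IsCMField.complexConj L) 2).Adelic)} : Set (quasiSplit (↥(maximalRealSubfield L)) L (IsCMField.complexConj L) 2).Adelic)).subgroupOf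
                        (Subgroup.centralizer ({((rep s.1 : ↥(quasiSplit (↥(maximalRealSubfield L)) L (IsCMField.complexConj L) 2).arithmeticSubgroup) : (quasiSplit (↥(maximalRealSubfield L)) L (IsCMField.complexConj L) 2).Adelic)} : Set (quasiSplit (↥(maximalRealSubfield L)) L (IsCMField.complexConj L) 2).Adelic)))
                        count (isClosed_inf_centralizer_subgroupOf_quasiSplit _) (νC s.1) Set.univ).toReal : ℂ) *
                      orbitalIntegral ((rep s.1 : ↥(quasiSplit (↥(maximalRealSubfield L)) L (IsCMField.complexConj L) 2).arithmeticSubgroup) : (quasiSplit (↥(maximalRealSubfield L)) L (IsCMField.complexConj L) 2).Adelic) (fun g₂ : (quasiSplit (↥(maximalRealSubfield L)) L (IsCMField.complexConj L) 2).Adelic => f (g₂, ((γ₁ : (cmDatum L 1 Φ₁).arithmeticSubgroup) : (cmDatum L 1 Φ₁).Adelic)))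
                        (quotientMeasure (Subgroup.centralizer ({((rep s.1 : ↥(quasiSplit (↥(maximalRealSubfield L)) L (IsCMField.complexConj L) 2).arithmeticSubgroup) : (quasiSplit (↥(maximalRealSubfield L)) L (IsCMField.complexConj L) 2).Adelic)} : Set (quasiSplit (↥(maximalRealSubfield L)) L (IsCMField.complexConj L) 2).Adelic)) (νC s.1)
                          (isClosed_centralizer_quasiSplit _) ν))) +
            ((∑ i ∈ ((finite_setOf_borelRefine_charpoly_of_isCompact (F := ↥(maximalRealSubfield L)) (E := L) (c := IsCMField.complexConj L) (N := 2)
              (hslice γ₁).hasCompactSupport'.isCompact).toFinset).filter (fun i : (AdeleRing (𝓞 L) L)[X] × Bool => i.2 = true ∧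
                ∃ z : Lˣ, (IsCMField.complexConj L) (z : L) * (z : L) = 1 ∧
                  i.1 = ((X - C (z : L)) ^ 2).map (algebraMap L (AdeleRing (𝓞 L) L))),
                ((μ.real Set.univ : ℝ) • (fun g₂ : (quasiSplit (↥(maximalRealSubfield L)) L (IsCMField.complexConj L) 2).Adelic => f (g₂, ((γ₁ : (cmDatum L 1 Φ₁).arithmeticSubgroup) : (cmDatum L 1 Φ₁).Adelic))) ((quasiSplit (↥(maximalRealSubfield L)) L (IsCMField.complexConj L) 2).toAdelic (ratCenter (↥(maximalRealSubfield L)) L (IsCMField.complexConj L) 2 ((StdForm.antidiagonal 2).over L) (zrep γ₁ i))) +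
                  ((unfoldingConstant (quasiSplit (↥(maximalRealSubfield L)) L (IsCMField.complexConj L) 2).quotientSubgroup
                      (count : Measure (quasiSplit (↥(maximalRealSubfield L)) L (IsCMField.complexConj L) 2).quotientSubgroup) μ ν : ℝ) : ℂ) *
                    (((𝔠 : ℝ) : ℂ) * ((1 : ℂ) *
                      ((1 / 2 : ℂ) * (-(((idelicCovolume (↥(maximalRealSubfield L)) νF).toReal : ℂ) * ((Real.log (borelHeight (1 : (quasiSplit (↥(maximalRealSubfield L)) L (IsCMField.complexConj L) 2).Adelic) : ℝ) : ℝ) : ℂ)) *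
                            (((μA (adeleFundamentalDomain (↥(maximalRealSubfield L)))).toReal⁻¹ : ℂ) * adeleFourier (↥(maximalRealSubfield L)) μA (fun x : AdeleRing (𝓞 (↥(maximalRealSubfield L))) (↥(maximalRealSubfield L)) => ∫ k, (fun g₂ : (quasiSplit (↥(maximalRealSubfield L)) L (IsCMField.complexConj L) 2).Adelic => f (g₂, ((γ₁ : (cmDatum L 1 Φ₁).arithmeticSubgroup) : (cmDatum L 1 Φ₁).Adelic))) ((k : (quasiSplit (↥(maximalRealSubfield L)) L (IsCMField.complexConj L) 2).Adelic)⁻¹ * (((quasiSplit (↥(maximalRealSubfield L)) L (IsCMField.complexConj L) 2).toAdelic (ratCenter (↥(maximalRealSubfield L)) L (IsCMField.complexConj L) 2 ((StdForm.antidiagonal 2).over L) (zrep γ₁ i))) * ((middleRootUnipotent hij hN (Multiplicative.ofAdd (traceZeroLine (↥(maximalRealSubfield L)) L (IsCMField.complexConj L) hcδ hδ x)) : adelicUnipotent (↥(maximalRealSubfield L)) L (IsCMField.complexConj L) 2) : (quasiSplit (↥(maximalRealSubfield L)) L (IsCMField.complexConj L) 2).Adelic)) * (k : (quasiSplit (↥(maximalRealSubfield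 L)) L (IsCMField.complexConj L) 2).Adelic)) ∂μK) 0) +
                          ((∫ x in {x | 1 ≤ (IdeleClassGroup.ideleNorm (↥(maximalRealSubfield L)) x : ℝ)} ∩ 𝓕F,
                              ideleSum (↥(maximalRealSubfield L)) (fun x : AdeleRing (𝓞 (↥(maximalRealSubfield L))) (↥(maximalRealSubfield L)) => ∫ k, (fun g₂ : (quasiSplit (↥(maximalRealSubfield L)) L (IsCMField.complexConj L) 2).Adelic => f (g₂, ((γ₁ : (cmDatum L 1 Φ₁).arithmeticSubgroup) : (cmDatum L 1 Φ₁).Adelic))) ((k : (quasiSplit (↥(maximalRealSubfield L)) L (IsCMField.complexConj L) 2).Adelic)⁻¹ * (((quasiSplit (↥(maximalRealSubfield L)) L (IsCMField.complexConj L) 2).toAdelic (ratCenter (↥(maximalRealSubfield L)) L (IsCMField.complexConj L) 2 ((StdForm.antidiagonal 2).over L) (zrep γ₁ i))) * ((middleRootUnipotent hij hN (Multiplicative.ofAdd (traceZeroLine (↥(maximalRealSubfield L)) L (IsCMField.complexConj L) hcδ hδ x)) : adelicUnipotent (↥(maximalRealSubfield L)) L (IsCMField.complexConj L) 2) : (quasiSplit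 (↥(maximalRealSubfield L)) L (IsCMField.complexConj L) 2).Adelic)) * (k : (quasiSplit (↥(maximalRealSubfield L)) L (IsCMField.complexConj L) 2).Adelic)) ∂μK) x * ((IdeleClassGroup.ideleNorm (↥(maximalRealSubfield L)) x : ℝ) : ℂ) ∂νF) +
                            ((μA (adeleFundamentalDomain (↥(maximalRealSubfield L)))).toReal⁻¹ : ℂ) *
                              (∫ x in {x | 1 ≤ (IdeleClassGroup.ideleNorm (↥(maximalRealSubfield L)) x : ℝ)} ∩ 𝓕F,
                                ideleSum (↥(maximalRealSubfield L)) (adeleFourier (↥(maximalRealSubfield L)) μA (fun x : AdeleRing (𝓞 (↥(maximalRealSubfield L))) (↥(maximalRealSubfield L)) => ∫ k, (fun g₂ : (quasiSplit (↥(maximalRealSubfield L)) L (IsCMField.complexConj L) 2).Adelic => f (g₂, ((γ₁ : (cmDatum L 1 Φ₁).arithmeticSubgroup) : (cmDatum L 1 Φ₁).Adelic))) ((k : (quasiSplit (↥(maximalRealSubfield L)) L (IsCMField.complexConj L) 2).Adelic)⁻¹ * (((quasiSplit (↥(maximalRealSubfield L)) L (IsCMField.complexConj L) 2).toAdelic (ratCenter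 (↥(maximalRealSubfield L)) L (IsCMField.complexConj L) 2 ((StdForm.antidiagonal 2).over L) (zrep γ₁ i))) * ((middleRootUnipotent hij hN (Multiplicative.ofAdd (traceZeroLine (↥(maximalRealSubfield L)) L (IsCMField.complexConj L) hcδ hδ x)) : adelicUnipotent (↥(maximalRealSubfield L)) L (IsCMField.complexConj L) 2) : (quasiSplit (↥(maximalRealSubfield L)) L (IsCMField.complexConj L) 2).Adelic)) * (k : (quasiSplit (↥(maximalRealSubfield L)) L (IsCMField.complexConj L) 2).Adelic)) ∂μK)) x ∂νF) -
                            ((idelicCovolume (↥(maximalRealSubfield L)) νF).toReal : ℂ) * (fun x : AdeleRing (𝓞 (↥(maximalRealSubfield L))) (↥(maximalRealSubfield L)) => ∫ k, (fun g₂ : (quasiSplit (↥(maximalRealSubfield L)) L (IsCMField.complexConj L) 2).Adelic => f (g₂, ((γ₁ : (cmDatum L 1 Φ₁).arithmeticSubgroup) : (cmDatum L 1 Φ₁).Adelic))) ((k : (quasiSplit (↥(maximalRealSubfield L)) L (IsCMField.complexConj L) 2).Adelic)⁻¹ * (((quasiSplit (↥(maximalRealSubfield L)) L (IsCMField.complexConj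 L) 2).toAdelic (ratCenter (↥(maximalRealSubfield L)) L (IsCMField.complexConj L) 2 ((StdForm.antidiagonal 2).over L) (zrep γ₁ i))) * ((middleRootUnipotent hij hN (Multiplicative.ofAdd (traceZeroLine (↥(maximalRealSubfield L)) L (IsCMField.complexConj L) hcδ hδ x)) : adelicUnipotent (↥(maximalRealSubfield L)) L (IsCMField.complexConj L) 2) : (quasiSplit (↥(maximalRealSubfield L)) L (IsCMField.complexConj L) 2).Adelic)) * (k : (quasiSplit (↥(maximalRealSubfield L)) L (IsCMField.complexConj L) 2).Adelic)) ∂μK) 0)) +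
                        (1 / 2 : ℂ) * ((∫ x in {x | 1 ≤ (IdeleClassGroup.ideleNorm (↥(maximalRealSubfield L)) x : ℝ)} ∩ 𝓕F,
                            ideleSum (↥(maximalRealSubfield L)) (fun x : AdeleRing (𝓞 (↥(maximalRealSubfield L))) (↥(maximalRealSubfield L)) => ∫ k, (fun g₂ : (quasiSplit (↥(maximalRealSubfield L)) L (IsCMField.complexConj L) 2).Adelic => f (g₂, ((γ₁ : (cmDatum L 1 Φ₁).arithmeticSubgroup) : (cmDatum L 1 Φ₁).Adelic))) ((k : (quasiSplit (↥(maximalRealSubfield L)) L (IsCMField.complexConj L) 2).Adelic)⁻¹ * (((quasiSplit (↥(maximalRealSubfield L)) L (IsCMField.complexConj L) 2).toAdelic (ratCenter (↥(maximalRealSubfield L)) L (IsCMField.complexConj L) 2 ((StdForm.antidiagonal 2).over L) (zrep γ₁ i))) * ((middleRootUnipotent hij hN (Multiplicative.ofAdd (traceZeroLine (↥(maximalRealSubfield L)) L (IsCMField.complexConj L) hcδ hδ x)) : adelicUnipotent (↥(maximalRealSubfield L)) L (IsCMField.complexConj L) 2) : (quasiSplit (↥(maximalRealSubfield L)) L (IsCMField.complexConj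 L) 2).Adelic)) * (k : (quasiSplit (↥(maximalRealSubfield L)) L (IsCMField.complexConj L) 2).Adelic)) ∂μK) x * (-1 : ℂ) ^ (quadraticArtinIndicator (↥(maximalRealSubfield L)) ((θ₀ : 𝓞 (↥(maximalRealSubfield L))) : (↥(maximalRealSubfield L))) x).val *
                              ((IdeleClassGroup.ideleNorm (↥(maximalRealSubfield L)) x : ℝ) : ℂ) ∂νF) +
                          ((μA (adeleFundamentalDomain (↥(maximalRealSubfield L)))).toReal⁻¹ : ℂ) *
                            ∫ x in {x | 1 ≤ (IdeleClassGroup.ideleNorm (↥(maximalRealSubfield L)) x : ℝ)} ∩ 𝓕F,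
                              ideleSum (↥(maximalRealSubfield L)) (adeleFourier (↥(maximalRealSubfield L)) μA (fun x : AdeleRing (𝓞 (↥(maximalRealSubfield L))) (↥(maximalRealSubfield L)) => ∫ k, (fun g₂ : (quasiSplit (↥(maximalRealSubfield L)) L (IsCMField.complexConj L) 2).Adelic => f (g₂, ((γ₁ : (cmDatum L 1 Φ₁).arithmeticSubgroup) : (cmDatum L 1 Φ₁).Adelic))) ((k : (quasiSplit (↥(maximalRealSubfield L)) L (IsCMField.complexConj L) 2).Adelic)⁻¹ * (((quasiSplit (↥(maximalRealSubfield L)) L (IsCMField.complexConj L) 2).toAdelic (ratCenter (↥(maximalRealSubfield L)) L (IsCMField.complexConj L) 2 ((StdForm.antidiagonal 2).over L) (zrep γ₁ i))) * ((middleRootUnipotent hij hN (Multiplicative.ofAdd (traceZeroLine (↥(maximalRealSubfield L)) L (IsCMField.complexConj L) hcδ hδ x)) : adelicUnipotent (↥(maximalRealSubfield L)) L (IsCMField.complexConj L) 2) : (quasiSplit (↥(maximalRealSubfield L)) L (IsCMField.complexConj L) 2).Adelic)) * (k : (quasiSplit (↥(maximalRealSubfield L)) L (IsCMField.complexConj L)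 2).Adelic)) ∂μK)) x *
                                (-1 : ℂ) ^ (quadraticArtinIndicator (↥(maximalRealSubfield L)) ((θ₀ : 𝓞 (↥(maximalRealSubfield L))) : (↥(maximalRealSubfield L))) x⁻¹).val ∂νF)))))) +
              (∑ i ∈ ((finite_setOf_borelRefine_charpoly_of_isCompact (F := ↥(maximalRealSubfield L)) (E := L) (c := IsCMField.complexConj L) (N := 2)
              (hslice γ₁).hasCompactSupport'.isCompact).toFinset).filter (fun i : (AdeleRing (𝓞 L) L)[X] × Bool => i.2 = true ∧
                ∃ a : Lˣ, (IsCMField.complexConj L) (a : L) * (a : L) ≠ 1 ∧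
                  i.1 = ((X - C (a : L)) * (X - C ((IsCMField.complexConj L) (a : L))⁻¹)).map (algebraMap L (AdeleRing (𝓞 L) L))),
                -(((unfoldingConstant (quasiSplit (↥(maximalRealSubfield L)) L (IsCMField.complexConj L) 2).quotientSubgroup
                    (count : Measure (quasiSplit (↥(maximalRealSubfield L)) L (IsCMField.complexConj L) 2).quotientSubgroup) μ ν : ℝ) : ℂ) *
                  (Cw.toReal : ℂ) *
                  ∫ x : (quasiSplit (↥(maximalRealSubfield L)) L (IsCMField.complexConj L) 2).Adelic ⧸
                      torusAdelic (↥(maximalRealSubfield L)) L (IsCMField.complexConj L) 2,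
                    (fun g₂ : (quasiSplit (↥(maximalRealSubfield L)) L (IsCMField.complexConj L) 2).Adelic => f (g₂, ((γ₁ : (cmDatum L 1 Φ₁).arithmeticSubgroup) : (cmDatum L 1 Φ₁).Adelic))) ((x.out : (quasiSplit (↥(maximalRealSubfield L)) L (IsCMField.complexConj L) 2).Adelic) *
                        (quasiSplit (↥(maximalRealSubfield L)) L (IsCMField.complexConj L) 2).toAdelic (hyrep γ₁ i) *
                        (x.out : (quasiSplit (↥(maximalRealSubfield L)) L (IsCMField.complexConj L) 2).Adelic)⁻¹) *
                      ((Real.log (borelHeight (x.out : (quasiSplit (↥(maximalRealSubfield L)) L (IsCMField.complexConj L) 2).Adelic)⁻¹) +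
                        Real.log (borelHeight ((quasiSplit (↥(maximalRealSubfield L)) L (IsCMField.complexConj L) 2).toAdelic w *
                          (x.out : (quasiSplit (↥(maximalRealSubfield L)) L (IsCMField.complexConj L) 2).Adelic)⁻¹)) : ℝ) : ℂ)
                    ∂(quotientMeasure (torusAdelic (↥(maximalRealSubfield L)) L (IsCMField.complexConj L) 2) ρ isClosed_torusAdelic ν))))) := by
  have h0 := arthurTrace_eq_spelled_cm_two L hij hN ν μ ν₀ 𝓕 h𝓕 rep hrep νC
      ρ hw hC hwin hβ μB μK μT μN hΩ hΩu hwT hcδ hδ θ₀ hθ hd μA νF h𝓕F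
  obtain ⟨𝔠, h𝔠, hall⟩ := h0
  choose zrep hyrep hJ using fun γ₁ : (cmDatum L 1 Φ₁).arithmeticSubgroup => hall (fun g₂ : (quasiSplit (↥(maximalRealSubfield L)) L (IsCMField.complexConj L) 2).Adelic => f (g₂, ((γ₁ : (cmDatum L 1 Φ₁).arithmeticSubgroup) : (cmDatum L 1 Φ₁).Adelic))) (hslice γ₁)
  refine ⟨𝔠, h𝔠, zrep, hyrep, ?_⟩
  congr 1
  exact Finset.sum_congr rfl fun γ₁ _ => hJ γ₁ 0

end UnitaryGroup

end Literature.NumberTheory.Automorphic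

end
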